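import Summits.PneNP.PneNP.Theorems.ChebyshevTracialDesignRungPiecesOneSided
import Summits.PneNP.PneNP.Theorems.ChebyshevTracialDesignCrossingPinTracial
import Summits.PneNP.PneNP.Theorems.ChebyshevTracialDesignGlobalMisalignmentCells
import Literature.Combinatorics.AssociationSchemes.CutMatchingRestrictionStrategies
import HarnessLib

/-!
# Cell pnp-psdrank, route `ChebyshevTracialDesign`: the CELLS of a psd strategy — restriction, trace marginals,
# crossing cells by the tracial crossing-pin lemma, non-crossing cells as REDUCED tight psd strategies against the reduced design

Harmonic backbone of the crux `TracialDecayExp20` (stmt-PneNP-19878), brick 51 (prover g11): the psd twin of bricks 30 (`…RungCells`)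
and 49 §1 (`…RungPiecesOneSided.noncrossing_cell_le`) — step S2 of the psd rung asked for in MEMO-12 §3 (3) / MEMO-13 §3 (3) («weighted
Kupavskii–Zakharov on the trace profile `y(M) = tr(Y_M)/r`»), on top of the literature glue
`Literature.Combinatorics.AssociationSchemes.CutMatchingRestrictionStrategies` (pair-level sum transport, lifted cuts/matchings,
`IsPsdRect.lift`). For a tight-orthogonal psd rectangle `(X, Y)` of dimension `r` (`IsPsdRect`: `0 ⪯ X_U, Y_M ⪯ I_r`, `X_U Y_M = 0` on the
tight pairs), the design weight `W = levelWeight n t C w`, a family `A` of `t`-cuts and a set `B` of perfect matchings: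
* §0 `sum_restrict_eq` — the cell value `Σ_{U∈A} Σ_{M∈B} W(U,M)·tr(X_U Y_M)` is the full value of the RESTRICTED pair
  `(X·1_A, Y·1_B)`, again a tight-orthogonal psd rectangle (`…GlobalMisalignmentCells.isPsdRect_restrict`);
* §1 TRACE MARGINALS `abs_cell_value_le_col` / `abs_cell_value_le_row` — `|cell value| ≤ (Σ_c|w_c|)·(Σ_{M∈B} tr Y_M)/|PM_n|` and
  `≤ (Σ_c|w_c|)·(Σ_{U∈A,|U|=t} tr X_U)/#{t-cuts}` (brick 21 `…APrioriBounds.abs_value_div_le` on the restricted pair): the psd form of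
  the uniform marginals `μ_c(A×B) ≤ |B|/|PM_n|`, pricing the Kupavskii–Zakharov remainder and the sparse reduced cells by TRACE MASS;
* §2 CROSSING CELLS `abs_psd_crossing_cell_le` — if an edge `{a,b} ⊆ V` crosses the pattern `π ⊆ V` and every `M ∈ B` contains `{a,b}`,
  `|Σ_{U∈A, U∩V=π} Σ_{M∈B} W·tr(X_U Y_M)| ≤ B_v·r·√P_{D−4}` (brick 24b `crossingPin_tracial_value_le_of_contractions` on the restricted pair);
* §3 NON-CROSSING CELLS — `psd_noncrossing_cell_eq_reduced_value`: for a core `S` (perfect matching of `V`, `|V| = 2s`) and a non-crossing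
  even pattern `π`, `Σ_{A_π × B} W·tr(X_U Y_M) = ρ_π(0)·Σ_{Ã × B̃} W'(Ũ,M̃)·tr(X̃_Ũ Ỹ_M̃)` with the REDUCED STRATEGY `X̃ = X ∘ liftOdd`,
  `Ỹ = Y ∘ liftPMatch` of `K_m` (`m = n − 2s`) and the REDUCED DESIGN `w'_c = w_c ρ_π(c)/ρ_π(0)` (brick 48: exact of degree `D − s`,
  variation `≤ B_v`); hence `psd_noncrossing_cell_le`: any bound `B_v·Φ` valid for the reduced strategy on `Ã × B̃` against all such
  reduced designs gives `cell ≤ 2·(|PM_m|/|PM_n|)·B_v·Φ` (`ρ_π(0) ≤ 2|PM_m|/|PM_n|`, `2s² + s ≤ n/2`).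
[cite: Rothvoss2017, §2 (PDF p. 6)] [cite: KupavskiiZakharov2022, §2 and Lemma 11] [cite: BrietDadushPokutta2014, Thm. 6 (§3)]
Stature: support/instrument (no defs). WHAT THIS IS NOT: not the psd rung (pieces and assembly are the next file), no estimate for the
dense non-crossing psd cell (the open core of the crux), nothing on psd rank, no P-vs-NP content. Supports stmt-PneNP-19878.
-/

set_option linter.dupNamespace false -- `Summit.PneNP.PneNP.…`: summit = sub-problem (D-0017)

noncomputable section

namespace Summit.PneNP.PneNP.Theorems.ChebyshevTracialDesignPsdCells

open Finset Matrix Polynomial Literature.Combinatorics.Optimization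
open Literature.Barriers.PneNP hiding verts
open Literature.Combinatorics.SetFamily
open Literature.Combinatorics.SimpleGraph.CycleSpace
open Literature.Combinatorics.AssociationSchemes.CutMatchingRestriction
open Literature.Combinatorics.AssociationSchemes.CutMatchingRestrictionStrategies
open Literature.Combinatorics.AssociationSchemes.HomogeneousMatchingFamilies
open Summit.PneNP.PneNP.Theorems.ChebyshevTracialDesignProfilePolynomial (card_pmatch_pos)
open Summit.PneNP.PneNP.Theorems.ChebyshevTracialDesignDipoleHitRatio (card_pmatch_eq_pmCount)
open Summit.PneNP.PneNP.Theorems.ChebyshevTracialDesignAPrioriBounds (abs_value_div_le)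
open Summit.PneNP.PneNP.Theorems.ChebyshevTracialDesignGlobalMisalignmentCells (isPsdRect_restrict)
open Summit.PneNP.PneNP.Theorems.ChebyshevTracialDesignCrossingPinTracial (crossingPin_tracial_value_le_of_contractions)
open Summit.PneNP.PneNP.Theorems.ChebyshevTracialDesignRungCells
open Summit.PneNP.PneNP.Theorems.ChebyshevTracialDesignRungPieces
open Summit.PneNP.PneNP.Theorems.ChebyshevTracialDesignNonCrossingCellDesign

variable {n : ℕ}

/-! ### §0 Cell values are values of restricted strategies -/

/-- **Cell value = full value of the restricted pair.** For any weight `W`, matrix-valued `X, Y` and index families `A`, `B`: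
`Σ_U Σ_M W(U,M)·tr((X·1_A)_U (Y·1_B)_M) = Σ_{U∈A} Σ_{M∈B} W(U,M)·tr(X_U Y_M)`. [cite: Rothvoss2017, §2 (PDF p. 6)] -/
theorem sum_restrict_eq (W : OddSet n → PMatch n → ℝ) {r : ℕ} (X : OddSet n → Matrix (Fin r) (Fin r) ℝ)
    (Y : PMatch n → Matrix (Fin r) (Fin r) ℝ) (A : Finset (OddSet n)) (B : Finset (PMatch n)) :
    ∑ U, ∑ M, W U M * ((if U ∈ A then X U else 0) * (if M ∈ B then Y M else 0)).trace =
      ∑ U ∈ A, ∑ M ∈ B, W U M * (X U * Y M).trace := by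
  classical
  have hg : ∀ U : OddSet n, U ∉ A →
      ∑ M, W U M * ((if U ∈ A then X U else 0) * (if M ∈ B then Y M else 0)).trace = 0 :=
    fun U hU => sum_eq_zero fun M _ => by rw [if_neg hU, Matrix.zero_mul, trace_zero, mul_zero]
  rw [← sum_subset (subset_univ A) (fun U _ hU => hg U hU)]
  refine sum_congr rfl fun U hU => ?_
  have hf : ∀ M : PMatch n, M ∉ B →
      W U M * ((if U ∈ A then X U else 0) * (if M ∈ B then Y M else 0)).trace = 0 :=
    fun M hM => by rw [if_neg hM, Matrix.mul_zero, trace_zero, mul_zero]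
  rw [← sum_subset (subset_univ B) (fun M _ hM => hf M hM)]
  exact sum_congr rfl fun M hM => by rw [if_pos hU, if_pos hM]

/-- The trace mass of a restricted matching-side strategy is its mass on the restricting family. [folklore] -/
theorem sum_trace_restrict {r : ℕ} {ι : Type*} [Fintype ι] [DecidableEq ι] (Y : ι → Matrix (Fin r) (Fin r) ℝ) (B : Finset ι) :
    ∑ M, (if M ∈ B then Y M else 0).trace = ∑ M ∈ B, (Y M).trace := by
  rw [← sum_subset (subset_univ B) (fun M _ hM => by rw [if_neg hM, trace_zero])]
  exact sum_congr rfl fun M hM => by rw [if_pos hM]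

/-! ### §1 Trace marginals: a cell is at most its column / row trace density -/

/-- **Column trace marginal.** For a tight-orthogonal psd rectangle `(X, Y)` of dimension `r ≥ 1`, any families `A`, `B` and any multilevel
weight on the `t`-cuts: `|Σ_{U∈A} Σ_{M∈B} W(U,M)·tr(X_U Y_M)| ≤ (Σ_{c∈C}|w_c|)·(Σ_{M∈B} tr Y_M)/|PM_n|` — the psd form of
`μ_c(A × B) ≤ |B|/|PM_n|` (uniform column marginal of `Q_c` and `tr(X_U Y_M) ≤ tr Y_M`). [cite: Rothvoss2017, §2 (PDF p. 6)] -/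
theorem abs_cell_value_le_col {t r : ℕ} (hr : 0 < r) (C : Finset ℕ) (w : ℕ → ℝ)
    {X : OddSet n → Matrix (Fin r) (Fin r) ℝ} {Y : PMatch n → Matrix (Fin r) (Fin r) ℝ} (hXY : IsPsdRect X Y)
    (A : Finset (OddSet n)) (B : Finset (PMatch n)) :
    |∑ U ∈ A, ∑ M ∈ B, levelWeight n t C w U M * (X U * Y M).trace| ≤
      (∑ c ∈ C, |w c|) * ((∑ M ∈ B, (Y M).trace) / Fintype.card (PMatch n)) := by
  classical
  have hr' : (0 : ℝ) < r := by exact_mod_cast hr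
  have hBw : 0 ≤ ∑ c ∈ C, |w c| := sum_nonneg fun c _ => abs_nonneg (w c)
  have h := abs_value_div_le (t := t) hr C w (isPsdRect_restrict hXY A B)
  beta_reduce at h
  rw [sum_restrict_eq, sum_trace_restrict Y B, abs_div, abs_of_pos hr'] at h
  have h2 := h.trans (mul_le_mul_of_nonneg_left (min_le_right _ _) hBw)
  have h3 : (∑ c ∈ C, |w c|) * ((∑ M ∈ B, (Y M).trace) / ((r : ℝ) * Fintype.card (PMatch n))) =
      (∑ c ∈ C, |w c|) * ((∑ M ∈ B, (Y M).trace) / Fintype.card (PMatch n)) / r := by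
    rw [mul_comm (r : ℝ) _, ← div_div, mul_div_assoc]
  rw [h3, div_le_div_iff_of_pos_right hr'] at h2
  exact h2

/-- **Row trace marginal.** Same with the cut side: `|Σ_{U∈A} Σ_{M∈B} W(U,M)·tr(X_U Y_M)| ≤ (Σ_{c∈C}|w_c|)·(Σ_{U∈A, |U|=t} tr X_U)/#{t-cuts}`.
[cite: Rothvoss2017, §2 (PDF p. 6)] -/
theorem abs_cell_value_le_row {t r : ℕ} (hr : 0 < r) (C : Finset ℕ) (w : ℕ → ℝ)
    {X : OddSet n → Matrix (Fin r) (Fin r) ℝ} {Y : PMatch n → Matrix (Fin r) (Fin r) ℝ} (hXY : IsPsdRect X Y)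
    (A : Finset (OddSet n)) (B : Finset (PMatch n)) :
    |∑ U ∈ A, ∑ M ∈ B, levelWeight n t C w U M * (X U * Y M).trace| ≤
      (∑ c ∈ C, |w c|) * ((∑ U ∈ A.filter (fun U => U.1.card = t), (X U).trace) /
        (univ.filter fun U : OddSet n => U.1.card = t).card) := by
  classical
  have hr' : (0 : ℝ) < r := by exact_mod_cast hr
  have hBw : 0 ≤ ∑ c ∈ C, |w c| := sum_nonneg fun c _ => abs_nonneg (w c)
  have h := abs_value_div_le (t := t) hr C w (isPsdRect_restrict hXY A B)
  beta_reduce at h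
  have hrow : ∑ U ∈ univ.filter (fun U : OddSet n => U.1.card = t), (if U ∈ A then X U else 0).trace =
      ∑ U ∈ A.filter (fun U => U.1.card = t), (X U).trace := by
    have hset : (univ.filter fun U : OddSet n => U.1.card = t).filter (fun U => U ∈ A) = A.filter (fun U => U.1.card = t) := by
      ext U; simp [and_comm]
    conv_rhs => rw [← hset, sum_filter]
    refine sum_congr rfl fun U _ => ?_
    split_ifs <;> simp
  rw [sum_restrict_eq, hrow, abs_div, abs_of_pos hr'] at h
  have h2 := h.trans (mul_le_mul_of_nonneg_left (min_le_left _ _) hBw)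
  have h3 : (∑ c ∈ C, |w c|) * ((∑ U ∈ A.filter (fun U => U.1.card = t), (X U).trace) /
        ((r : ℝ) * (univ.filter fun U : OddSet n => U.1.card = t).card)) =
      (∑ c ∈ C, |w c|) * ((∑ U ∈ A.filter (fun U => U.1.card = t), (X U).trace) /
        (univ.filter fun U : OddSet n => U.1.card = t).card) / r := by
    rw [mul_comm (r : ℝ) _, ← div_div, mul_div_assoc]
  rw [h3, div_le_div_iff_of_pos_right hr'] at h2
  exact h2

/-! ### §2 Crossing cells -/

/-- **Crossing cells are small, at every dimension.** For `n` even, an exact design `(n, t = 2c'+1, T, D, B_v, C, w)` with `4 ≤ D ≤ 2c'`, a vertex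
set `V` containing an edge `{a,b}` that CROSSES the pattern `π ⊆ V`, a tight-orthogonal psd rectangle `(X, Y)` of dimension `r`, a family `A`
of cuts and a set `B` of perfect matchings all containing `{a,b}`:
`|Σ_{U∈A, U∩V=π} Σ_{M∈B} W(U,M)·tr(X_U Y_M)| ≤ B_v·r·√P_{D−4}` (the tracial crossing-pin lemma on the restricted pair: every `U` with pattern
`π` is crossed by `{a,b}`). [cite: Rothvoss2017, §2 and Lemma 7 (PDF pp. 6–8)] [cite: GriblingDelaatLaurent2019, §5] -/
theorem abs_psd_crossing_cell_le {c' T D r : ℕ} {Bv : ℝ} {C : Finset ℕ} {w : ℕ → ℝ} (hn : Even n)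
    (hdes : IsExactDesign n (2 * c' + 1) T D Bv C w) (hD : D ≤ 2 * c') (hD4 : 4 ≤ D) {V π : Finset (Fin n)} {a b : Fin n}
    (ha : a ∈ V) (hb : b ∈ V) (hcross : Crosses π s(a, b))
    {X : OddSet n → Matrix (Fin r) (Fin r) ℝ} {Y : PMatch n → Matrix (Fin r) (Fin r) ℝ} (hXY : IsPsdRect X Y)
    (A : Finset (OddSet n)) (B : Finset (PMatch n)) (hB : ∀ M ∈ B, s(a, b) ∈ M.1) :
    |∑ U ∈ A.filter (fun U => U.1 ∩ V = π), ∑ M ∈ B, levelWeight n (2 * c' + 1) C w U M * (X U * Y M).trace| ≤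
      Bv * ((r : ℝ) * Real.sqrt (∏ i ∈ range ((D - 4) / 2 + 1), ((2 * i + 1 : ℝ) / ((n : ℝ) - 2 * i)))) := by
  classical
  set Aπ := A.filter (fun U => U.1 ∩ V = π) with hAπ
  have hres := isPsdRect_restrict hXY Aπ B
  have hXz : ∀ U : OddSet n, ¬ Crosses U.1 s(a, b) → (fun U => if U ∈ Aπ then X U else 0) U = 0 := by
    intro U hU
    by_cases hUA : U ∈ Aπ
    · exfalso
      have hUV : U.1 ∩ V = π := (mem_filter.1 hUA).2
      have he : s(a, b) ∈ V.sym2 := by simp [ha, hb]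
      exact hU (by rw [crosses_iff_crosses_inter he, hUV]; exact hcross)
    · simp only [hUA, if_false]
  have hYz : ∀ M : PMatch n, s(a, b) ∉ M.1 → (fun M => if M ∈ B then Y M else 0) M = 0 := by
    intro M hM
    by_cases hMB : M ∈ B
    · exact absurd (hB M hMB) hM
    · simp only [hMB, if_false]
  have key := crossingPin_tracial_value_le_of_contractions hn hdes hD hD4 a b _ _ hXz hYz hres.1 hres.2.1
  beta_reduce at key
  rwa [sum_restrict_eq] at key

/-! ### §3 Non-crossing cells: the reduced strategy against the reduced design -/

/-- **A non-crossing cell of a strategy, read on the reduced strategy against the reduced design.** For a perfect matching `S` of `V`, an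
even pattern `π ⊆ V` with `crossCount π S = 0` and `|π| ≤ t`, families `A` (cuts) and `B` (perfect matchings containing `S`), matrix-valued
`X, Y`, and a polynomial `ρ` with `ρ(0) ≠ 0` and `|Q''_c(m, t − |π|)| = ρ(c)·|Q_c(n, t)|` on the levels `c ∈ C'` (brick 48's class ratio):
`Σ_{U∈A, U∩V=π} Σ_{M∈B} W(U,M)·tr(X_U Y_M) = ρ(0) · Σ_{Ũ∈Ã} Σ_{M̃∈B̃} levelWeight m (t−|π|) C' w' (Ũ,M̃) · tr(X(liftOdd Ũ)·Y(liftPMatch M̃))`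
with `w'_c = w_c ρ(c)/ρ(0)`, `Ã = oddCellCuts A V π`, `B̃ = pmCellMatchings B V S`. [cite: Rothvoss2017, §2 (PDF p. 6, eq. (2))]
[cite: KupavskiiZakharov2022, §2 (p. 6)] -/
theorem psd_noncrossing_cell_eq_reduced_value {m t r : ℕ} (C' : Finset ℕ) (w : ℕ → ℝ) {V π : Finset (Fin n)}
    {S : Finset (Sym2 (Fin n))} (hS : IsPMOn V S) (hπ0 : crossCount π S = 0) (hπV : π ⊆ V) (hπe : Even π.card) (hp : π.card ≤ t)
    (h : (univ \ V).card = m) (X : OddSet n → Matrix (Fin r) (Fin r) ℝ) (Y : PMatch n → Matrix (Fin r) (Fin r) ℝ)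
    (A : Finset (OddSet n)) (B : Finset (PMatch n)) (hB : ∀ M ∈ B, S ⊆ M.1) (ρ : Polynomial ℝ) (hρ0 : ρ.eval 0 ≠ 0)
    (hρ : ∀ c ∈ C', ((Qset m (t - π.card) c).card : ℝ) = ρ.eval (c : ℝ) * (Qset n t c).card) :
    ∑ U ∈ A.filter (fun U => U.1 ∩ V = π), ∑ M ∈ B, levelWeight n t C' w U M * (X U * Y M).trace =
      ρ.eval 0 * ∑ Ut ∈ oddCellCuts A V π h, ∑ Mt ∈ pmCellMatchings B V S h,
        levelWeight m (t - π.card) C' (fun c => w c * ρ.eval (c : ℝ) / ρ.eval 0) Ut Mt *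
          (X (liftOdd V π h hπV hπe Ut) * Y (liftPMatch V S h hS Mt)).trace := by
  have hBf : B.filter (fun M => S ⊆ M.1) = B := filter_true_of_mem hB
  conv_lhs => rw [← hBf]
  rw [cell_value_eq_lift hS h hπV hπe t C' w X Y A B, hπ0, mul_sum]
  refine sum_congr rfl fun Ut _ => ?_
  rw [mul_sum]
  refine sum_congr rfl fun Mt _ => ?_
  rw [← mul_assoc]
  congr 1
  unfold levelFn levelWeight
  rw [add_zero, mul_sum]
  refine sum_congr rfl fun c hc => ?_
  by_cases hq : (Ut, Mt) ∈ Qset m (t - π.card) c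
  · obtain ⟨hq1, hq2⟩ := mem_Qset_iff.1 hq
    dsimp only at hq1 hq2
    have hcond : Ut.1.card + π.card = t ∧ cc Ut Mt = c := ⟨by rw [hq1]; exact Nat.sub_add_cancel hp, hq2⟩
    rw [if_pos hcond, if_pos hq]
    have hpos : (0 : ℝ) < (Qset m (t - π.card) c).card := by exact_mod_cast card_pos.2 ⟨_, hq⟩
    rw [hρ c hc] at hpos
    have hρc : ρ.eval (c : ℝ) ≠ 0 := fun h0 => by rw [h0, zero_mul] at hpos; exact lt_irrefl _ hpos
    have hQc : ((Qset n t c).card : ℝ) ≠ 0 := fun h0 => by rw [h0, mul_zero] at hpos; exact lt_irrefl _ hpos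
    rw [hρ c hc]
    field_simp
  · have hcond : ¬ (Ut.1.card + π.card = t ∧ cc Ut Mt = c) := fun hc' =>
      hq (mem_Qset_iff.2 ⟨by have := hc'.1; dsimp only; omega, hc'.2⟩)
    rw [if_neg hcond, if_neg hq, mul_zero]

/-- **A non-crossing cell of a strategy, one-sidedly, through the reduced design** (psd twin of brick 49 `noncrossing_cell_le`). Let `n` be even,
`(n, t = 2c'+1, T, D, B_v, C, w)` an exact design, `S` a perfect matching of `V` with `|V| = 2s`, `T + 2s + 2 ≤ t`, `s ≤ D`, `2s² + s ≤ n/2`,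
`π ⊆ V` a non-crossing (hence even) pattern, `|univ ∖ V| = m`, `A` a family of cuts, `B` a set of perfect matchings containing `S`, and `X, Y`
matrix-valued of dimension `r`. If for EVERY weight `w'` on the levels `C` that is exact of degree `D − s` with `Σ|w'_c| ≤ B_v` the REDUCED
STRATEGY satisfies `Σ_{Ũ∈Ã} Σ_{M̃∈B̃} levelWeight m (t−|π|) C w' (Ũ,M̃)·tr(X(liftOdd Ũ) Y(liftPMatch M̃)) ≤ B_v·Φ` (given that the classes
`Q_c(m, t−|π|)`, `c ∈ C`, are nonempty), then `Σ_{U∈A, U∩V=π} Σ_{M∈B} W(U,M)·tr(X_U Y_M) ≤ 2·(|PM_m|/|PM_n|)·B_v·Φ`.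
[cite: Rothvoss2017, §2 (PDF p. 6)] [cite: KupavskiiZakharov2022, §2] -/
theorem psd_noncrossing_cell_le {c' T Dg m s r : ℕ} {Bv Φ : ℝ} {C : Finset ℕ} {w : ℕ → ℝ} (hn : Even n)
    (hdes : IsExactDesign n (2 * c' + 1) T Dg Bv C w) {V π : Finset (Fin n)} {S : Finset (Sym2 (Fin n))} (hS : IsPMOn V S)
    (hVs : V.card = 2 * s) (hTs : T + 2 * s + 2 ≤ 2 * c' + 1) (hsD : s ≤ Dg) (hsN : 2 * s * s + s ≤ n / 2)
    (hπ0 : crossCount π S = 0) (hπV : π ⊆ V) (hπe : Even π.card) (h : (univ \ V).card = m)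
    (X : OddSet n → Matrix (Fin r) (Fin r) ℝ) (Y : PMatch n → Matrix (Fin r) (Fin r) ℝ)
    (A : Finset (OddSet n)) (B : Finset (PMatch n)) (hB : ∀ M ∈ B, S ⊆ M.1) (hΦ : 0 ≤ Φ)
    (hred : (∀ c ∈ C, (Qset m (2 * c' + 1 - π.card) c).Nonempty) → ∀ w' : ℕ → ℝ,
      (∀ p : Polynomial ℝ, p.natDegree ≤ Dg - s → ∑ c ∈ C, w' c * p.eval (c : ℝ) = -p.eval 0) →
      ∑ c ∈ C, |w' c| ≤ Bv →
      ∑ Ut ∈ oddCellCuts A V π h, ∑ Mt ∈ pmCellMatchings B V S h,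
        levelWeight m (2 * c' + 1 - π.card) C w' Ut Mt *
          (X (liftOdd V π h hπV hπe Ut) * Y (liftPMatch V S h hS Mt)).trace ≤ Bv * Φ) :
    ∑ U ∈ A.filter (fun U => U.1 ∩ V = π), ∑ M ∈ B, levelWeight n (2 * c' + 1) C w U M * (X U * Y M).trace ≤
      2 * ((Fintype.card (PMatch m) : ℝ) / Fintype.card (PMatch n)) * (Bv * Φ) := by
  classical
  have ht2 : 2 * (2 * c' + 1) + 2 ≤ n := hdes.2.1
  have hC := hdes.2.2.2.1
  have hexact := hdes.2.2.2.2.2.1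
  have hBvar := hdes.2.2.2.2.2.2
  have hBv : 0 ≤ Bv := (sum_nonneg fun c _ => abs_nonneg (w c)).trans hBvar
  obtain ⟨N, hN⟩ := hn
  have hN2 : n / 2 = N := by omega
  -- `π` is a union of edges of `S`: even, of size `2p₁ ≤ 2s`
  obtain ⟨p₁, hp₁⟩ := id hπe
  have hπcard : π.card = 2 * p₁ := by omega
  have hp₁s : p₁ ≤ s := by have := card_le_card hπV; omega
  have hVn : V.card ≤ n := by simpa using card_le_univ V
  have hms : m + 2 * s = n := by rw [← h, card_univ_sdiff, Fintype.card_fin]; omega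
  have hmeven : Even m := ⟨N - s, by omega⟩
  have ht'' : 2 * c' + 1 - π.card = 2 * (c' - p₁) + 1 := by omega
  have hPMn : (0 : ℝ) < Fintype.card (PMatch n) := by exact_mod_cast card_pmatch_pos ⟨N, hN⟩
  have hPMm : (0 : ℝ) < Fintype.card (PMatch m) := by exact_mod_cast card_pmatch_pos hmeven
  have hprodN : 0 < ∏ j ∈ range s, (((n / 2 : ℕ) : ℝ) - j) := by
    refine prod_pos fun j hj => ?_
    have := mem_range.1 hj
    have : (j : ℝ) < ((n / 2 : ℕ) : ℝ) := by exact_mod_cast (show j < n / 2 by nlinarith)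
    linarith
  -- the class-ratio polynomial
  set κ₀ : ℝ := ((Fintype.card (PMatch m) : ℝ) / Fintype.card (PMatch n)) / ∏ j ∈ range s, (((n / 2 : ℕ) : ℝ) - j) with hκ₀
  have hκ₀pos : 0 < κ₀ := by rw [hκ₀]; positivity
  set a : ℝ := ((n : ℝ) - (2 * c' + 1 : ℕ)) / 2 with ha
  set b : ℝ := (((2 * c' + 1 : ℕ) : ℝ)) / 2 with hb
  set ρ : Polynomial ℝ := Polynomial.C κ₀ *
      (∏ j ∈ range (s - p₁), (Polynomial.C (a - j) - Polynomial.C (1 / 2 : ℝ) * Polynomial.X)) *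
    ∏ j ∈ range p₁, (Polynomial.C (b - j) - Polynomial.C (1 / 2 : ℝ) * Polynomial.X) with hρ
  have hρdeg : ρ.natDegree ≤ s := natDegree_cellRatio_le κ₀ a b s p₁ hp₁s
  have hρeval : ∀ x : ℝ, ρ.eval x = κ₀ * (∏ j ∈ range (s - p₁), (a - x / 2 - j)) * ∏ j ∈ range p₁, (b - x / 2 - j) :=
    fun x => eval_cellRatio κ₀ a b s p₁ x
  -- positivity / monotonicity on `[0, T]`
  have hposle : ∀ x : ℝ, 0 ≤ x → x ≤ T → 0 < ρ.eval x ∧ ρ.eval x ≤ ρ.eval 0 := by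
    intro x hx0 hxT
    rw [hρeval, hρeval]
    refine cellRatio_eval_pos_le hκ₀pos hx0 ?_ ?_
    · rw [ha, Nat.cast_sub hp₁s]
      have : (T : ℝ) + 2 * s + 2 ≤ (2 * c' + 1 : ℕ) := by exact_mod_cast hTs
      have : (2 * ((2 * c' + 1 : ℕ) : ℝ)) + 2 ≤ n := by exact_mod_cast ht2
      linarith
    · rw [hb]
      have : (T : ℝ) + 2 * s + 2 ≤ (2 * c' + 1 : ℕ) := by exact_mod_cast hTs
      have : (p₁ : ℝ) ≤ s := by exact_mod_cast hp₁s
      linarith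
  have hρ0 : 0 < ρ.eval 0 := (hposle 0 le_rfl (Nat.cast_nonneg T)).1
  -- the identity `|Q''_c| = ρ(c)|Q_c|` on the design levels
  have hratio : ∀ c ∈ C, ((Qset m (2 * c' + 1 - π.card) c).card : ℝ) = ρ.eval (c : ℝ) * (Qset n (2 * c' + 1) c).card := by
    intro c hc
    obtain ⟨⟨m₁, hm₁⟩, -, hcT, -⟩ := hC c hc
    rw [ht'', hm₁, hρ, ha, hb]
    exact cellRatio_eq_eval ⟨N, hN⟩ hms hp₁s (by omega) (by omega)
  -- `ρ(0) ≤ 2 |PM_m|/|PM_n|`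
  have hρ0le : ρ.eval 0 ≤ 2 * ((Fintype.card (PMatch m) : ℝ) / Fintype.card (PMatch n)) := by
    rw [hρeval, hκ₀, mul_assoc, div_mul_eq_mul_div, div_le_iff₀ hprodN]
    have hN2R : (((n / 2 : ℕ) : ℝ)) = (n : ℝ) / 2 := by
      rw [hN2]
      have hnR : (n : ℝ) = N + N := by exact_mod_cast hN
      rw [hnR]; ring
    have haN : a ≤ ((n / 2 : ℕ) : ℝ) := by
      rw [ha, hN2R]
      have : (0 : ℝ) ≤ ((2 * c' + 1 : ℕ) : ℝ) := Nat.cast_nonneg _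
      linarith
    have hbN : b ≤ ((n / 2 : ℕ) : ℝ) := by
      rw [hb, hN2R]
      have : (2 * ((2 * c' + 1 : ℕ) : ℝ)) + 2 ≤ n := by exact_mod_cast ht2
      linarith
    have hcore := cellRatio_zero_core_le (N := n / 2) (s := s) (p₁ := p₁) (a := a) (b := b) hp₁s hsN haN hbN
      (fun j hj => by
        have := mem_range.1 hj
        rw [ha]
        have h1 : (j : ℝ) + 1 ≤ ((s - p₁ : ℕ) : ℝ) := by exact_mod_cast this
        rw [Nat.cast_sub hp₁s] at h1
        have : (T : ℝ) + 2 * s + 2 ≤ (2 * c' + 1 : ℕ) := by exact_mod_cast hTs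
        have : (2 * ((2 * c' + 1 : ℕ) : ℝ)) + 2 ≤ n := by exact_mod_cast ht2
        linarith)
      (fun j hj => by
        have := mem_range.1 hj
        rw [hb]
        have h1 : (j : ℝ) + 1 ≤ (p₁ : ℝ) := by exact_mod_cast this
        have : (T : ℝ) + 2 * s + 2 ≤ (2 * c' + 1 : ℕ) := by exact_mod_cast hTs
        have : (p₁ : ℝ) ≤ s := by exact_mod_cast hp₁s
        linarith)
    calc (Fintype.card (PMatch m) : ℝ) / Fintype.card (PMatch n) *
          ((∏ j ∈ range (s - p₁), (a - 0 / 2 - j)) * ∏ j ∈ range p₁, (b - 0 / 2 - j))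
        ≤ (Fintype.card (PMatch m) : ℝ) / Fintype.card (PMatch n) * (2 * ∏ j ∈ range s, (((n / 2 : ℕ) : ℝ) - j)) :=
          mul_le_mul_of_nonneg_left hcore (by positivity)
      _ = _ := by ring
  -- nonempty reduced level classes
  have hQm : ∀ c ∈ C, (Qset m (2 * c' + 1 - π.card) c).Nonempty := by
    intro c hc
    obtain ⟨-, -, hcT, hne⟩ := hC c hc
    have hpos : (0 : ℝ) < (Qset m (2 * c' + 1 - π.card) c).card := by
      rw [hratio c hc]
      exact mul_pos (hposle c (Nat.cast_nonneg c) (by exact_mod_cast hcT)).1 (by exact_mod_cast card_pos.2 hne)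
    exact card_pos.1 (by exact_mod_cast hpos)
  -- the reduced design
  set w' : ℕ → ℝ := fun c => w c * ρ.eval (c : ℝ) / ρ.eval 0 with hw'
  have hexact' : ∀ p : Polynomial ℝ, p.natDegree ≤ Dg - s → ∑ c ∈ C, w' c * p.eval (c : ℝ) = -p.eval 0 :=
    reducedDesign_exact hsD hexact ρ hρdeg hρ0.ne'
  have hvar' : ∑ c ∈ C, |w' c| ≤ Bv := by
    refine (reducedDesign_variation_le ρ hρ0 fun c hc => ?_).trans hBvar
    obtain ⟨-, -, hcT, -⟩ := hC c hc
    have h := hposle c (Nat.cast_nonneg c) (by exact_mod_cast hcT)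
    exact ⟨h.1.le, h.2⟩
  -- value identity and the bound
  rw [psd_noncrossing_cell_eq_reduced_value C w hS hπ0 hπV hπe (by omega) h X Y A B hB ρ hρ0.ne' hratio]
  have hval := hred hQm w' hexact' hvar'
  calc ρ.eval 0 * ∑ Ut ∈ oddCellCuts A V π h, ∑ Mt ∈ pmCellMatchings B V S h,
        levelWeight m (2 * c' + 1 - π.card) C w' Ut Mt *
          (X (liftOdd V π h hπV hπe Ut) * Y (liftPMatch V S h hS Mt)).trace
      ≤ ρ.eval 0 * (Bv * Φ) := mul_le_mul_of_nonneg_left hval hρ0.le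
    _ ≤ 2 * ((Fintype.card (PMatch m) : ℝ) / Fintype.card (PMatch n)) * (Bv * Φ) :=
        mul_le_mul_of_nonneg_right hρ0le (mul_nonneg hBv hΦ)

end Summit.PneNP.PneNP.Theorems.ChebyshevTracialDesignPsdCells
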